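import Mathlib
import HarnessLib
import Literature.MathematicalPhysics.QuantumLattice.HubbardBondAlgebra
import Literature.MathematicalPhysics.QuantumLattice.ApproximatingHamiltonianProofs
import Literature.MathematicalPhysics.QuantumLattice.HubbardGaugeBound
import Summits.HubbardSuperconductivity.HubbardSuperconductivity.Theorems.ThermalWedgeTwSeededEnsembleEquivalenceRGibbsFactorisation

/-!
# Route `ThermalWedge`, crux `TwSeededEnsembleEquivalenceR` (stmt-HubbardSuperconductivity-15581):
# abstract cut lemmas for positive-temperature partition functions of lattice fermions

Support file (`--supports stmt-HubbardSuperconductivity-15581`; no definition; the route file is NOT imported).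
Second layer of the infrastructure for the registered stub `stub_sourcedPressureLimit` (thermodynamic limit of
the sourced torus pressure). For REAL parameters `β ≥ 0`, `U`, `μ`, a Hermitian Hamiltonian `H` on the Fock
space of a finite linearly ordered site set `Λ`, and Hermitian even "interaction parts" `Q_i` of smaller site
sets `Λ_i` embedded by order embeddings `e_i : Λ_i ↪o Λ` with disjoint ranges covering `Λ`:

* `twR_partitionFn_onSiteSum` — `Z_β(V_Λ) = z₀(β,U,μ)^{|Λ|}` with the REAL one-site factor `z₀ > 0`;
* `twR_partitionFn_atomic_add_jwEmbed` — `Z_β(V_Λ + e_* Q) = Z_β(V_{Λ₁} + Q) · z₀^{|Λ| - |Λ₁|}`;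
* `twR_partitionFn_atomic_add_add_jwEmbed` — `Z_β(V_Λ + e₁_* Q₁ + e₂_* Q₂) = Z_β(V₁ + Q₁) · Z_β(V₂ + Q₂)`;
* `twR_abs_log_partitionFn_sub_cut_le` — if `‖H - (V_Λ + e₁_* Q₁ + e₂_* Q₂)‖ ≤ D` then
  `|log Z_β(H) - (log Z_β(V₁ + Q₁) + log Z_β(V₂ + Q₂))| ≤ βD` (the boundary estimate of the
  thermodynamic limit by sub-additivity, Ruelle 1969 §2.2, for lattice fermions);
* `twR_abs_log_partitionFn_sub_embed_le` — one block: `|log Z_β(H) - (log Z_β(V₁ + Q) + (|Λ|-|Λ₁|) log z₀)| ≤ βD`.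

Ruelle, *Statistical Mechanics: Rigorous Results* (1969) §2.2; Ueltschi, J. Stat. Phys. 95 (1999) 693, §2.1.
Everything is [folklore] over the tree facts `twR_gibbsFactorisation` (this seat, T1),
`abs_log_partitionFn_sub_log_partitionFn_le`, `trace_exp_neg_onSiteSum`, `atomicPartitionFn_ofReal`.
-/

set_option linter.dupNamespace false

noncomputable section

namespace Summit.HubbardSuperconductivity.HubbardSuperconductivity.Theorems

open Literature.MathematicalPhysics.QuantumLattice Matrix Finset HubbardWave0
open scoped BigOperators Matrix.Norms.L2Operator

/-! ### The atomic Hamiltonian `V_Λ` for real parameters -/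

section Atomic

variable {Λ : Type*} [LinearOrder Λ] [Fintype Λ]

/-- `V_Λ` is the Hubbard Hamiltonian at zero hopping (any graph; here the empty one). [folklore] -/
theorem twR_onSiteSum_eq_hamiltonianWith_zero (U μ : ℝ) :
    onSiteSum (U : ℂ) (μ : ℂ) (Finset.univ : Finset Λ) = hamiltonianWith (⊥ : SimpleGraph Λ) 0 U μ := by
  rw [hamiltonianWith_zero_hopping, onSiteSum_univ]

/-- `V_Λ` is Hermitian for real `U, μ`. [folklore] -/
theorem twR_onSiteSum_isHermitian (U μ : ℝ) :
    (onSiteSum (U : ℂ) (μ : ℂ) (Finset.univ : Finset Λ)).IsHermitian := by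
  rw [twR_onSiteSum_eq_hamiltonianWith_zero]
  exact isHermitian_hamiltonianWith _ 0 U μ

omit [LinearOrder Λ] [Fintype Λ] in
/-- The Gibbs exponent of `V + Q`: `-β(V + Q) = -(βV) + (-βQ)`. [folklore] -/
theorem twR_neg_smul_add (β : ℝ) (V Q : Matrix (Finset (Orb Λ)) (Finset (Orb Λ)) ℂ) :
    -((β : ℂ) • (V + Q)) = -((β : ℂ) • V) + -((β : ℂ) • Q) := by
  rw [smul_add, neg_add]

/-- `Z_β(H) = Tr exp(-(βH))` (the tree's `gibbsWeight` is `(-β) • H`; `neg_smul`). [folklore] -/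
theorem twR_partitionFn_eq_trace_exp (β : ℝ) (H : Matrix (Finset (Orb Λ)) (Finset (Orb Λ)) ℂ) :
    partitionFn β H = (NormedSpace.exp (-((β : ℂ) • H))).trace := by
  rw [partitionFn, gibbsWeight, neg_smul]

/-- **Atomic partition function**: `Z_β(V_Λ) = z₀(β, U, μ)^{|Λ|}` (real one-site factor). [folklore] -/
theorem twR_partitionFn_onSiteSum (β U μ : ℝ) :
    partitionFn β (onSiteSum (U : ℂ) (μ : ℂ) (Finset.univ : Finset Λ)) =
      ((atomicPartitionFnReal β U μ ^ Fintype.card Λ : ℝ) : ℂ) := by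
  rw [twR_partitionFn_eq_trace_exp, trace_exp_neg_onSiteSum, Finset.card_univ, Nat.sub_self, pow_zero, mul_one,
    atomicPartitionFn_ofReal, Complex.ofReal_pow]

/-- `log Z_β(V_Λ) = |Λ| log z₀`. [folklore] -/
theorem twR_log_partitionFn_onSiteSum (β U μ : ℝ) :
    Real.log (partitionFn β (onSiteSum (U : ℂ) (μ : ℂ) (Finset.univ : Finset Λ))).re =
      Fintype.card Λ * Real.log (atomicPartitionFnReal β U μ) := by
  rw [twR_partitionFn_onSiteSum, Complex.ofReal_re, Real.log_pow]

/-- `-βQ` is even-local whenever `Q` is. [folklore] -/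
theorem twR_neg_smul_mem {S : Finset (Orb Λ)} {Q : Matrix (Finset (Orb Λ)) (Finset (Orb Λ)) ℂ}
    (hQ : Q ∈ carEvenSubalgebra S) (β : ℝ) : -((β : ℂ) • Q) ∈ carEvenSubalgebra S :=
  Subalgebra.neg_mem _ (Subalgebra.smul_mem _ hQ _)

end Atomic

/-! ### One embedded block -/

section OneBlock

variable {Λ Λ₁ : Type*} [LinearOrder Λ] [Fintype Λ] [LinearOrder Λ₁] [Fintype Λ₁]

/-- **Volume independence, partition-function form**: for an even `Q` on `Λ₁` and an order embedding
`e : Λ₁ ↪o Λ`, `Z_β(V_Λ + e_* Q) = Z_β(V_{Λ₁} + Q) · z₀^{|Λ| - |Λ₁|}`. [folklore] -/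
theorem twR_partitionFn_atomic_add_jwEmbed (e : Λ₁ ↪o Λ) (β U μ : ℝ)
    {Q : Matrix (Finset (Orb Λ₁)) (Finset (Orb Λ₁)) ℂ}
    (hQ : Q ∈ carEvenSubalgebra (orbs (Finset.univ : Finset Λ₁))) :
    partitionFn β (onSiteSum (U : ℂ) (μ : ℂ) (Finset.univ : Finset Λ) + jwEmbed (orbEmb e) Q) =
      partitionFn β (onSiteSum (U : ℂ) (μ : ℂ) (Finset.univ : Finset Λ₁) + Q) *
        ((atomicPartitionFnReal β U μ ^ (Fintype.card Λ - Fintype.card Λ₁) : ℝ) : ℂ) := by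
  have key := twR_trace_exp_atomic_add_jwEmbed e (β : ℂ) (U : ℂ) (μ : ℂ) (twR_neg_smul_mem hQ β)
  rw [atomicPartitionFn_ofReal, map_neg, map_smul] at key
  rw [twR_partitionFn_eq_trace_exp, twR_partitionFn_eq_trace_exp, twR_neg_smul_add, twR_neg_smul_add,
    Complex.ofReal_pow]
  exact key

/-- **One-block boundary estimate**: if `‖H - (V_Λ + e_* Q)‖ ≤ D` (`H`, `Q` Hermitian, `Q` even, `β ≥ 0`),
then `|log Z_β(H) - (log Z_β(V_{Λ₁} + Q) + (|Λ| - |Λ₁|) log z₀)| ≤ βD`. [folklore] -/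
theorem twR_abs_log_partitionFn_sub_embed_le (e : Λ₁ ↪o Λ) {β : ℝ} (hβ : 0 ≤ β) (U μ : ℝ)
    {H : Matrix (Finset (Orb Λ)) (Finset (Orb Λ)) ℂ} (hH : H.IsHermitian)
    {Q : Matrix (Finset (Orb Λ₁)) (Finset (Orb Λ₁)) ℂ} (hQh : Q.IsHermitian)
    (hQ : Q ∈ carEvenSubalgebra (orbs (Finset.univ : Finset Λ₁))) {D : ℝ}
    (hD : ‖H - (onSiteSum (U : ℂ) (μ : ℂ) (Finset.univ : Finset Λ) + jwEmbed (orbEmb e) Q)‖ ≤ D) :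
    |Real.log (partitionFn β H).re -
        (Real.log (partitionFn β (onSiteSum (U : ℂ) (μ : ℂ) (Finset.univ : Finset Λ₁) + Q)).re +
          ((Fintype.card Λ - Fintype.card Λ₁ : ℕ) : ℝ) * Real.log (atomicPartitionFnReal β U μ))| ≤ β * D := by
  have hH' : (onSiteSum (U : ℂ) (μ : ℂ) (Finset.univ : Finset Λ) + jwEmbed (orbEmb e) Q).IsHermitian := by
    refine (twR_onSiteSum_isHermitian U μ).add ?_
    rw [IsHermitian, ← jwEmbed_conjTranspose, hQh.eq]
  have hlip := abs_log_partitionFn_sub_log_partitionFn_le hH hH' hβ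
  have hZ := twR_partitionFn_atomic_add_jwEmbed e β U μ hQ
  have hz₀ : 0 < atomicPartitionFnReal β U μ := atomicPartitionFnReal_pos β U μ
  have hZ₁ : 0 < (partitionFn β (onSiteSum (U : ℂ) (μ : ℂ) (Finset.univ : Finset Λ₁) + Q)).re :=
    partitionFn_re_pos ((twR_onSiteSum_isHermitian U μ).add hQh) β
  have hre : (partitionFn β (onSiteSum (U : ℂ) (μ : ℂ) (Finset.univ : Finset Λ) + jwEmbed (orbEmb e) Q)).re =
      (partitionFn β (onSiteSum (U : ℂ) (μ : ℂ) (Finset.univ : Finset Λ₁) + Q)).re *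
        atomicPartitionFnReal β U μ ^ (Fintype.card Λ - Fintype.card Λ₁) := by
    rw [hZ, Complex.re_mul_ofReal]
  rw [hre, Real.log_mul hZ₁.ne' (pow_pos hz₀ _).ne', Real.log_pow] at hlip
  exact hlip.trans (mul_le_mul_of_nonneg_left hD hβ)

end OneBlock

/-! ### Two embedded blocks with complementary ranges -/

section TwoBlocks

variable {Λ Λ₁ Λ₂ : Type*} [LinearOrder Λ] [Fintype Λ] [LinearOrder Λ₁] [Fintype Λ₁]
  [LinearOrder Λ₂] [Fintype Λ₂]

/-- **Exact factorisation over two complementary embedded blocks**: if the ranges of `e₁`, `e₂` are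
disjoint and `|Λ₁| + |Λ₂| = |Λ|`, then for even `Q₁`, `Q₂`,
`Z_β(V_Λ + e₁_* Q₁ + e₂_* Q₂) = Z_β(V_{Λ₁} + Q₁) · Z_β(V_{Λ₂} + Q₂)`. [folklore] -/
theorem twR_partitionFn_atomic_add_add_jwEmbed (e₁ : Λ₁ ↪o Λ) (e₂ : Λ₂ ↪o Λ)
    (hdisj : Disjoint ((Finset.univ : Finset Λ₁).map e₁.toEmbedding) ((Finset.univ : Finset Λ₂).map e₂.toEmbedding))
    (hcard : Fintype.card Λ₁ + Fintype.card Λ₂ = Fintype.card Λ) (β U μ : ℝ)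
    {Q₁ : Matrix (Finset (Orb Λ₁)) (Finset (Orb Λ₁)) ℂ} (hQ₁ : Q₁ ∈ carEvenSubalgebra (orbs (Finset.univ : Finset Λ₁)))
    {Q₂ : Matrix (Finset (Orb Λ₂)) (Finset (Orb Λ₂)) ℂ} (hQ₂ : Q₂ ∈ carEvenSubalgebra (orbs (Finset.univ : Finset Λ₂))) :
    partitionFn β (onSiteSum (U : ℂ) (μ : ℂ) (Finset.univ : Finset Λ) + jwEmbed (orbEmb e₁) Q₁ + jwEmbed (orbEmb e₂) Q₂) =
      partitionFn β (onSiteSum (U : ℂ) (μ : ℂ) (Finset.univ : Finset Λ₁) + Q₁) *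
        partitionFn β (onSiteSum (U : ℂ) (μ : ℂ) (Finset.univ : Finset Λ₂) + Q₂) := by
  -- the embedded exponents
  set P₁ := jwEmbed (orbEmb e₁) (-((β : ℂ) • Q₁)) with hP₁
  set P₂ := jwEmbed (orbEmb e₂) (-((β : ℂ) • Q₂)) with hP₂
  have mP₁ : P₁ ∈ carEvenSubalgebra (orbs ((Finset.univ : Finset Λ₁).map e₁.toEmbedding)) :=
    twR_jwEmbed_mem_carEvenSubalgebra e₁ (fun i _ => twR_orbEmb_mem_orbs_map e₁ i) (twR_neg_smul_mem hQ₁ β)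
  have mP₂ : P₂ ∈ carEvenSubalgebra (orbs ((Finset.univ : Finset Λ₂).map e₂.toEmbedding)) :=
    twR_jwEmbed_mem_carEvenSubalgebra e₂ (fun i _ => twR_orbEmb_mem_orbs_map e₂ i) (twR_neg_smul_mem hQ₂ β)
  have fac := twR_trace_exp_atomic_add_add_mul (β : ℂ) (U : ℂ) (μ : ℂ) hdisj mP₁ mP₂
  have v₁ := twR_trace_exp_atomic_add_jwEmbed e₁ (β : ℂ) (U : ℂ) (μ : ℂ) (twR_neg_smul_mem hQ₁ β)
  have v₂ := twR_trace_exp_atomic_add_jwEmbed e₂ (β : ℂ) (U : ℂ) (μ : ℂ) (twR_neg_smul_mem hQ₂ β)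
  have v₀ := trace_exp_neg_onSiteSum (β : ℂ) (U : ℂ) (μ : ℂ) (Finset.univ : Finset Λ)
  rw [Finset.card_univ, Nat.sub_self, pow_zero, mul_one] at v₀
  -- rewrite everything in terms of traces of exponentials
  have eL : partitionFn β (onSiteSum (U : ℂ) (μ : ℂ) (Finset.univ : Finset Λ) + jwEmbed (orbEmb e₁) Q₁ + jwEmbed (orbEmb e₂) Q₂) =
      (NormedSpace.exp (-((β : ℂ) • onSiteSum (U : ℂ) (μ : ℂ) (Finset.univ : Finset Λ)) + P₁ + P₂)).trace := by
    rw [twR_partitionFn_eq_trace_exp, smul_add, smul_add, neg_add, neg_add, hP₁, hP₂, map_neg, map_smul, map_neg, map_smul]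
  have e1 : partitionFn β (onSiteSum (U : ℂ) (μ : ℂ) (Finset.univ : Finset Λ₁) + Q₁) =
      (NormedSpace.exp (-((β : ℂ) • onSiteSum (U : ℂ) (μ : ℂ) (Finset.univ : Finset Λ₁)) + -((β : ℂ) • Q₁))).trace := by
    rw [twR_partitionFn_eq_trace_exp, twR_neg_smul_add]
  have e2 : partitionFn β (onSiteSum (U : ℂ) (μ : ℂ) (Finset.univ : Finset Λ₂) + Q₂) =
      (NormedSpace.exp (-((β : ℂ) • onSiteSum (U : ℂ) (μ : ℂ) (Finset.univ : Finset Λ₂)) + -((β : ℂ) • Q₂))).trace := by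
    rw [twR_partitionFn_eq_trace_exp, twR_neg_smul_add]
  set z := atomicPartitionFn (β : ℂ) (U : ℂ) (μ : ℂ) with hz
  have hz0 : z ≠ 0 := by
    rw [hz, atomicPartitionFn_ofReal]; exact_mod_cast (atomicPartitionFnReal_pos β U μ).ne'
  have hle₁ : Fintype.card Λ₁ ≤ Fintype.card Λ := Fintype.card_le_of_embedding e₁.toEmbedding
  have hle₂ : Fintype.card Λ₂ ≤ Fintype.card Λ := Fintype.card_le_of_embedding e₂.toEmbedding
  have hexp : Fintype.card Λ - Fintype.card Λ₁ + (Fintype.card Λ - Fintype.card Λ₂) = Fintype.card Λ := by omega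
  set T := (NormedSpace.exp (-((β : ℂ) • onSiteSum (U : ℂ) (μ : ℂ) (Finset.univ : Finset Λ)) + P₁ + P₂)).trace
  set Z₁ := (NormedSpace.exp (-((β : ℂ) • onSiteSum (U : ℂ) (μ : ℂ) (Finset.univ : Finset Λ₁)) + -((β : ℂ) • Q₁))).trace
  set Z₂ := (NormedSpace.exp (-((β : ℂ) • onSiteSum (U : ℂ) (μ : ℂ) (Finset.univ : Finset Λ₂)) + -((β : ℂ) • Q₂))).trace
  rw [eL, e1, e2]
  rw [v₀, v₁, v₂] at fac
  -- `T · z^{|Λ|} = Z₁ z^{a} · Z₂ z^{b}` with `a + b = |Λ|`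
  have key : T * z ^ Fintype.card Λ = Z₁ * Z₂ * z ^ Fintype.card Λ := by
    calc T * z ^ Fintype.card Λ
        = Z₁ * z ^ (Fintype.card Λ - Fintype.card Λ₁) * (Z₂ * z ^ (Fintype.card Λ - Fintype.card Λ₂)) := fac
      _ = Z₁ * Z₂ * (z ^ (Fintype.card Λ - Fintype.card Λ₁) * z ^ (Fintype.card Λ - Fintype.card Λ₂)) := by ring
      _ = Z₁ * Z₂ * z ^ Fintype.card Λ := by rw [← pow_add, hexp]
  exact mul_right_cancel₀ (pow_ne_zero _ hz0) key

/-- **Two-block boundary estimate** (the sub-additivity step of the thermodynamic limit for lattice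
fermions): if `‖H - (V_Λ + e₁_* Q₁ + e₂_* Q₂)‖ ≤ D` with `H`, `Q_i` Hermitian, `Q_i` even, disjoint
complementary ranges and `β ≥ 0`, then `|log Z_β(H) - (log Z_β(V₁ + Q₁) + log Z_β(V₂ + Q₂))| ≤ βD`.
[folklore] -/
theorem twR_abs_log_partitionFn_sub_cut_le (e₁ : Λ₁ ↪o Λ) (e₂ : Λ₂ ↪o Λ)
    (hdisj : Disjoint ((Finset.univ : Finset Λ₁).map e₁.toEmbedding) ((Finset.univ : Finset Λ₂).map e₂.toEmbedding))
    (hcard : Fintype.card Λ₁ + Fintype.card Λ₂ = Fintype.card Λ) {β : ℝ} (hβ : 0 ≤ β) (U μ : ℝ)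
    {H : Matrix (Finset (Orb Λ)) (Finset (Orb Λ)) ℂ} (hH : H.IsHermitian)
    {Q₁ : Matrix (Finset (Orb Λ₁)) (Finset (Orb Λ₁)) ℂ} (hQ₁h : Q₁.IsHermitian)
    (hQ₁ : Q₁ ∈ carEvenSubalgebra (orbs (Finset.univ : Finset Λ₁)))
    {Q₂ : Matrix (Finset (Orb Λ₂)) (Finset (Orb Λ₂)) ℂ} (hQ₂h : Q₂.IsHermitian)
    (hQ₂ : Q₂ ∈ carEvenSubalgebra (orbs (Finset.univ : Finset Λ₂))) {D : ℝ}
    (hD : ‖H - (onSiteSum (U : ℂ) (μ : ℂ) (Finset.univ : Finset Λ) + jwEmbed (orbEmb e₁) Q₁ + jwEmbed (orbEmb e₂) Q₂)‖ ≤ D) :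
    |Real.log (partitionFn β H).re -
        (Real.log (partitionFn β (onSiteSum (U : ℂ) (μ : ℂ) (Finset.univ : Finset Λ₁) + Q₁)).re +
          Real.log (partitionFn β (onSiteSum (U : ℂ) (μ : ℂ) (Finset.univ : Finset Λ₂) + Q₂)).re)| ≤ β * D := by
  have hJ₁ : (jwEmbed (orbEmb e₁) Q₁).IsHermitian := by rw [IsHermitian, ← jwEmbed_conjTranspose, hQ₁h.eq]
  have hJ₂ : (jwEmbed (orbEmb e₂) Q₂).IsHermitian := by rw [IsHermitian, ← jwEmbed_conjTranspose, hQ₂h.eq]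
  have hH' : (onSiteSum (U : ℂ) (μ : ℂ) (Finset.univ : Finset Λ) + jwEmbed (orbEmb e₁) Q₁ +
      jwEmbed (orbEmb e₂) Q₂).IsHermitian := ((twR_onSiteSum_isHermitian U μ).add hJ₁).add hJ₂
  have hlip := abs_log_partitionFn_sub_log_partitionFn_le hH hH' hβ
  have hZ := twR_partitionFn_atomic_add_add_jwEmbed e₁ e₂ hdisj hcard β U μ hQ₁ hQ₂
  have h₁ := (twR_onSiteSum_isHermitian (Λ := Λ₁) U μ).add hQ₁h
  have h₂ := (twR_onSiteSum_isHermitian (Λ := Λ₂) U μ).add hQ₂h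
  have hZ₁ := partitionFn_re_pos h₁ β
  have hZ₂ := partitionFn_re_pos h₂ β
  have hre : (partitionFn β (onSiteSum (U : ℂ) (μ : ℂ) (Finset.univ : Finset Λ) + jwEmbed (orbEmb e₁) Q₁ +
      jwEmbed (orbEmb e₂) Q₂)).re =
      (partitionFn β (onSiteSum (U : ℂ) (μ : ℂ) (Finset.univ : Finset Λ₁) + Q₁)).re *
        (partitionFn β (onSiteSum (U : ℂ) (μ : ℂ) (Finset.univ : Finset Λ₂) + Q₂)).re := by
    rw [hZ, partitionFn_eq_re h₁, partitionFn_eq_re h₂, ← Complex.ofReal_mul, Complex.ofReal_re, Complex.ofReal_re,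
      Complex.ofReal_re]
  rw [hre, Real.log_mul hZ₁.ne' hZ₂.ne'] at hlip
  exact hlip.trans (mul_le_mul_of_nonneg_left hD hβ)

end TwoBlocks

/-! ### Summary (registered sub-goal of stmt-HubbardSuperconductivity-15581) -/

/-- **Registered sub-goal `twR_cutEstimate`** (infrastructure for `stub_sourcedPressureLimit`): the two-block
boundary estimate for lattice-fermion partition functions, for site types in `Type`. [folklore] -/
theorem twR_cutEstimate : ∀ (Λ Λ₁ Λ₂ : Type) [LinearOrder Λ] [Fintype Λ] [LinearOrder Λ₁] [Fintype Λ₁] [LinearOrder Λ₂] [Fintype Λ₂] (e₁ : Λ₁ ↪o Λ) (e₂ : Λ₂ ↪o Λ), Disjoint ((Finset.univ : Finset Λ₁).map e₁.toEmbedding) ((Finset.univ : Finset Λ₂).map e₂.toEmbedding) → Fintype.card Λ₁ + Fintype.card Λ₂ = Fintype.card Λ → ∀ (β U μ D : ℝ), 0 ≤ β → ∀ (H : Matrix (Finset (Orb Λ)) (Finset (Orb Λ)) ℂ) (Q₁ : Matrix (Finset (Orb Λ₁)) (Finset (Orb Λ₁)) ℂ) (Q₂ : Matrix (Finset (Orb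 Λ₂)) (Finset (Orb Λ₂)) ℂ), H.IsHermitian → Q₁.IsHermitian → Q₂.IsHermitian → Q₁ ∈ carEvenSubalgebra (orbs (Finset.univ : Finset Λ₁)) → Q₂ ∈ carEvenSubalgebra (orbs (Finset.univ : Finset Λ₂)) → ‖H - (onSiteSum (U : ℂ) (μ : ℂ) (Finset.univ : Finset Λ) + jwEmbed (orbEmb e₁) Q₁ + jwEmbed (orbEmb e₂) Q₂)‖ ≤ D → |Real.log (Matrix.partitionFn β H).re - (Real.log (Matrix.partitionFn β (onSiteSum (U : ℂ) (μ : ℂ) (Finset.univ : Finset Λ₁) + Q₁)).re + Real.log (Matrix.partitionFn β (onSiteSum (U : ℂ) (μ : ℂ) (Finset.univ : Finset Λ₂) + Q₂)).re)| ≤ β * D :=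
  fun _ _ _ _ _ _ _ _ _ e₁ e₂ hdisj hcard _ U μ _ hβ _ _ _ hH hQ₁h hQ₂h hQ₁ hQ₂ hD =>
    twR_abs_log_partitionFn_sub_cut_le e₁ e₂ hdisj hcard hβ U μ hH hQ₁h hQ₁ hQ₂h hQ₂ hD

end Summit.HubbardSuperconductivity.HubbardSuperconductivity.Theorems

end
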